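import Summits.ValiantsHypothesis.ValiantsHypothesis.Theorems.LacunarySymmetroidMatrixDescartesDoorA26WallBubblingNewtonLift

/-!
# `DoorA26` / line `wall_bubbling` — THE NEWTON-POLYGON LIFT FOR POLYNOMIAL FAMILIES OF LETTERS OF ANY DEGREE

HONEST FRAMING.  Object-search cell `pub-symmetroid`, crux `Theses.LacunarySymmetroid.DoorA26` (stmt-ValiantsHypothesis-19979; OPEN, typed,
never asserted).  W2 seat val-sym-door-p1 g20, file #83; def-free helper for obligation (R) of `Cruxes/DoorA26/Lines/wall_bubbling.lean`.
Imports #79 `…NewtonLift`.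

WHY.  #79 `mem_twentyLocus_of_newton_openings` takes the determinant of the family as a polynomial in `η` with exponential-sum coefficients
(hypothesis `hF`); its instances `_linear` / `_quadratic` (#79) and #82 (cubic) discharge `hF` degree by degree.  A rank-one zero of order `m`
opened along the slope `−2` edge needs a family of degree `⌊m/2⌋` (memo `DOOR-A26-P1G20-NEWTON-LIFT.md` §1), i.e. up to degree `10`; this file
discharges `hF` ONCE for every degree: for letters `T a` (`a ≤ h`) the family `Σ_a η^a T a` has determinant `Σ_{n ≤ 2h} ηⁿ c_n` with
`c_n(t) = Σ_{a+b=n} M(Q_a(t), Q_b(t))`, `M(X,Y) = X₀₀Y₁₁ − X₀₁Y₁₀` (the mixed `2 × 2` determinant; `M(X,X) = det X`, `M(X,Y)+M(Y,X) = pol(X,Y)`),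
each `c_n` an exponential sum on the exponents `δ_l + δ_{l'}`.  With it, the TRANSVERSAL case of every multiplicity pattern (jet map onto ⇒ letters
`T_1, …, T_h` with the even-step jets, solved order by order on paper) lands in #79 without any further format work.

WHAT IS HERE.  `expPencil_polyFamily` (the pencil of the family is `Σ_a η^a Q_a`), `det_polyFamily_fin_two` (its determinant, fiberwise in `a + b`),
`mixedDet_expPencil` (the mixed determinant of two pencils as an exponential sum on `Fin 6 × Fin 6`), ★★ `mem_twentyLocus_of_newton_openings_polyFamily`
(#79 for polynomial families of letters of any degree `h`, coefficients `c_n` as explicit functions).  Nothing here bears on `DoorA26`, `DoorA34`,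
(W)/(M)/(R), `MatrixDescartes` (18050) or `VP ≠ VNP`; registers unchanged.

[folklore] bilinearity of the `2 × 2` determinant.  [this work] the packaging.
-/

set_option linter.dupNamespace false

namespace Summit.ValiantsHypothesis.ValiantsHypothesis.Theorems.LacunarySymmetroidMatrixDescartes.WallBubbling

open Finset Filter Topology
open Bubbling (TwentyLocus expSum)

/-- The pencil of the family `Σ_a η^a T a` is `Σ_a η^a Q_a`. [folklore] -/
theorem expPencil_polyFamily (δ : Fin 6 → ℝ) {h : ℕ} (T : Fin (h + 1) → Fin 6 → Matrix (Fin 2) (Fin 2) ℝ) (η t : ℝ) :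
    (∑ l, Real.exp (δ l * t) • ∑ a : Fin (h + 1), η ^ (a : ℕ) • T a l)
      = ∑ a : Fin (h + 1), η ^ (a : ℕ) • ∑ l, Real.exp (δ l * t) • T a l := by
  simp only [Finset.smul_sum]
  rw [Finset.sum_comm]
  exact Finset.sum_congr rfl fun a _ => Finset.sum_congr rfl fun l _ => by rw [smul_comm]

/-- The `2 × 2` determinant of a polynomial family, fiberwise in the total degree: `det(Σ_a η^a Q_a) = Σ_{n ≤ 2h} ηⁿ Σ_{a+b=n} M(Q_a, Q_b)` with the
mixed determinant `M(X,Y) = X₀₀Y₁₁ − X₀₁Y₁₀`. [folklore] -/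
theorem det_polyFamily_fin_two {h : ℕ} (Q : Fin (h + 1) → Matrix (Fin 2) (Fin 2) ℝ) (η : ℝ) :
    (∑ a : Fin (h + 1), η ^ (a : ℕ) • Q a).det
      = ∑ n : Fin (2 * h + 1), η ^ (n : ℕ) *
          ∑ ab ∈ (Finset.univ : Finset (Fin (h + 1) × Fin (h + 1))).filter (fun ab => (ab.1 : ℕ) + ab.2 = n),
            ((Q ab.1) 0 0 * (Q ab.2) 1 1 - (Q ab.1) 0 1 * (Q ab.2) 1 0) := by
  classical
  -- expand the determinant into a double sum over `(a, b)`
  have hentry : ∀ i j, (∑ a : Fin (h + 1), η ^ (a : ℕ) • Q a) i j = ∑ a : Fin (h + 1), η ^ (a : ℕ) * (Q a) i j := by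
    intro i j; simp only [Matrix.sum_apply, Matrix.smul_apply, smul_eq_mul]
  have hL : (∑ a : Fin (h + 1), η ^ (a : ℕ) • Q a).det
      = ∑ ab : Fin (h + 1) × Fin (h + 1), η ^ ((ab.1 : ℕ) + ab.2) * ((Q ab.1) 0 0 * (Q ab.2) 1 1 - (Q ab.1) 0 1 * (Q ab.2) 1 0) := by
    rw [Matrix.det_fin_two, hentry, hentry, hentry, hentry, Finset.sum_mul_sum, Finset.sum_mul_sum, ← Finset.sum_sub_distrib]
    simp only [← Finset.sum_sub_distrib]
    rw [← Finset.sum_product', Finset.univ_product_univ]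
    refine Finset.sum_congr rfl fun ab _ => ?_
    rw [pow_add]; ring
  rw [hL, ← Finset.sum_fiberwise_of_maps_to
    (g := fun ab : Fin (h + 1) × Fin (h + 1) => (⟨(ab.1 : ℕ) + ab.2, by omega⟩ : Fin (2 * h + 1)))
    (fun _ _ => Finset.mem_univ _)]
  refine Finset.sum_congr rfl fun n _ => ?_
  rw [Finset.mul_sum]
  have hfilt : (Finset.univ.filter fun ab : Fin (h + 1) × Fin (h + 1) => (⟨(ab.1 : ℕ) + ab.2, by omega⟩ : Fin (2 * h + 1)) = n)
      = Finset.univ.filter fun ab : Fin (h + 1) × Fin (h + 1) => (ab.1 : ℕ) + ab.2 = n := by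
    ext ab
    simp only [Finset.mem_filter, Finset.mem_univ, true_and, Fin.ext_iff]
  rw [hfilt]
  refine Finset.sum_congr rfl fun ab hab => ?_
  rw [Finset.mem_filter] at hab
  rw [hab.2]

/-- The mixed determinant of two pencils as an exponential sum on `Fin 6 × Fin 6` (exponents `δ_l + δ_{l'}`). [folklore] -/
theorem mixedDet_expPencil (δ : Fin 6 → ℝ) (U V : Fin 6 → Matrix (Fin 2) (Fin 2) ℝ) (t : ℝ) :
    (∑ l, Real.exp (δ l * t) • U l) 0 0 * (∑ l, Real.exp (δ l * t) • V l) 1 1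
      - (∑ l, Real.exp (δ l * t) • U l) 0 1 * (∑ l, Real.exp (δ l * t) • V l) 1 0
      = expSum (fun p : Fin 6 × Fin 6 => (U p.1) 0 0 * (V p.2) 1 1 - (U p.1) 0 1 * (V p.2) 1 0) (fun p => δ p.1 + δ p.2) t := by
  classical
  simp only [Matrix.sum_apply, Matrix.smul_apply, smul_eq_mul]
  rw [Finset.sum_mul_sum, Finset.sum_mul_sum, ← Finset.sum_sub_distrib]
  simp only [← Finset.sum_sub_distrib]
  unfold Bubbling.expSum
  rw [← Finset.sum_product', Finset.univ_product_univ]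
  refine Finset.sum_congr rfl fun p _ => ?_
  rw [add_mul, Real.exp_add]
  ring

/-- ★★ **THE NEWTON-POLYGON LIFT FOR A POLYNOMIAL FAMILY OF LETTERS OF ANY DEGREE.**  Symmetric letters `T a` (`a ≤ h`), family `Σ_a η^a T a`, pencils
`Q_a`, coefficients `c_n(t) = Σ_{a+b=n} M(Q_a(t), Q_b(t))` (`n ≤ 2h`); separated points with Newton data `(α_j, β_j, k_{j,n})` for the `c_n`, scaling
polynomials with `m_j + 1` alternation witnesses as in #79; `Σ m_j ≥ 20` ⇒ `δ ∈ TwentyLocus`. [this work] -/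
theorem mem_twentyLocus_of_newton_openings_polyFamily (δ : Fin 6 → ℝ) {h : ℕ} (T : Fin (h + 1) → Fin 6 → Matrix (Fin 2) (Fin 2) ℝ)
    (hT : ∀ a l, (T a l).IsSymm)
    {r : ℕ} (z : Fin r → ℝ) {ρ : ℝ} (hρ : 0 < ρ) (hsep : ∀ i j : Fin r, i < j → z i + ρ ≤ z j - ρ)
    (m : Fin r → ℕ) (hm : 20 ≤ ∑ j, m j)
    (α : Fin r → ℝ) (hα : ∀ j, 0 < α j) (β : Fin r → ℝ) (k : Fin r → Fin (2 * h + 1) → ℕ)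
    (hvan : ∀ j (n : Fin (2 * h + 1)), ∀ i < k j n, iteratedDeriv i (fun t =>
      ∑ ab ∈ (Finset.univ : Finset (Fin (h + 1) × Fin (h + 1))).filter (fun ab => (ab.1 : ℕ) + ab.2 = n),
        ((∑ l, Real.exp (δ l * t) • T ab.1 l) 0 0 * (∑ l, Real.exp (δ l * t) • T ab.2 l) 1 1
          - (∑ l, Real.exp (δ l * t) • T ab.1 l) 0 1 * (∑ l, Real.exp (δ l * t) • T ab.2 l) 1 0)) (z j) = 0)
    (hβ : ∀ j (n : Fin (2 * h + 1)), β j ≤ ((n : ℕ) : ℝ) + α j * k j n)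
    (σ : (j : Fin r) → Fin (m j + 1) → ℝ) (hσ : ∀ j, StrictMono (σ j)) (hσ0 : ∀ j i, σ j i ≠ 0)
    (ε : (j : Fin r) → Fin (m j + 1) → ℝ) (hεalt : ∀ j (i : Fin (m j)), ε j i.castSucc * ε j i.succ < 0)
    (hM : ∀ j i, 0 < ε j i * ∑ n : Fin (2 * h + 1), if ((n : ℕ) : ℝ) + α j * k j n = β j then
        iteratedDeriv (k j n) (fun t =>
          ∑ ab ∈ (Finset.univ : Finset (Fin (h + 1) × Fin (h + 1))).filter (fun ab => (ab.1 : ℕ) + ab.2 = n),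
            ((∑ l, Real.exp (δ l * t) • T ab.1 l) 0 0 * (∑ l, Real.exp (δ l * t) • T ab.2 l) 1 1
              - (∑ l, Real.exp (δ l * t) • T ab.1 l) 0 1 * (∑ l, Real.exp (δ l * t) • T ab.2 l) 1 0)) (z j)
          / (k j n).factorial * σ j i ^ (k j n) else 0) :
    δ ∈ TwentyLocus := by
  classical
  -- the family
  let Sη : ℝ → Fin 6 → Matrix (Fin 2) (Fin 2) ℝ := fun η l => ∑ a : Fin (h + 1), η ^ (a : ℕ) • T a l
  have hSη : ∀ η l, (Sη η l).IsSymm := by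
    intro η l
    show (∑ a : Fin (h + 1), η ^ (a : ℕ) • T a l).IsSymm
    unfold Matrix.IsSymm
    rw [Matrix.transpose_sum]
    exact Finset.sum_congr rfl fun a _ => by rw [Matrix.transpose_smul, (hT a l).eq]
  -- coefficient vectors on `Fin 6 × Fin 6`
  let ι := Fin 6 × Fin 6
  let x : ι → ℝ := fun p => δ p.1 + δ p.2
  let cf : Fin (h + 1) → Fin (h + 1) → ι → ℝ := fun a b p => (T a p.1) 0 0 * (T b p.2) 1 1 - (T a p.1) 0 1 * (T b p.2) 1 0
  let c : Fin (2 * h + 1) → ι → ℝ := fun n p =>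
    ∑ ab ∈ (Finset.univ : Finset (Fin (h + 1) × Fin (h + 1))).filter (fun ab => (ab.1 : ℕ) + ab.2 = n), cf ab.1 ab.2 p
  -- the explicit coefficient functions are these exponential sums
  have hc : ∀ n : Fin (2 * h + 1), (fun t =>
      ∑ ab ∈ (Finset.univ : Finset (Fin (h + 1) × Fin (h + 1))).filter (fun ab => (ab.1 : ℕ) + ab.2 = n),
        ((∑ l, Real.exp (δ l * t) • T ab.1 l) 0 0 * (∑ l, Real.exp (δ l * t) • T ab.2 l) 1 1
          - (∑ l, Real.exp (δ l * t) • T ab.1 l) 0 1 * (∑ l, Real.exp (δ l * t) • T ab.2 l) 1 0)) = expSum (c n) x := by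
    intro n
    funext t
    rw [Finset.sum_congr rfl (fun ab _ => mixedDet_expPencil δ (T ab.1) (T ab.2) t)]
    unfold Bubbling.expSum
    rw [Finset.sum_comm]
    refine Finset.sum_congr rfl fun p _ => ?_
    rw [Finset.sum_mul]
  -- the determinant of the family
  have hF : ∀ η t, (∑ l, Real.exp (δ l * t) • Sη η l).det = ∑ n : Fin (2 * h + 1), η ^ (n : ℕ) * expSum (c n) x t := by
    intro η t
    show (∑ l, Real.exp (δ l * t) • ∑ a : Fin (h + 1), η ^ (a : ℕ) • T a l).det = _
    rw [expPencil_polyFamily, det_polyFamily_fin_two]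
    refine Finset.sum_congr rfl fun n _ => ?_
    congr 1
    exact congrFun (hc n) t
  -- transport the hypotheses and conclude with #79
  have hvan' : ∀ j (n : Fin (2 * h + 1)), ∀ i < k j n, iteratedDeriv i (expSum (c n) x) (z j) = 0 := by
    intro j n i hi
    rw [← hc n]
    exact hvan j n i hi
  have hM' : ∀ j i, 0 < ε j i * ∑ n : Fin (2 * h + 1), (if ((n : ℕ) : ℝ) + α j * k j n = β j then
      iteratedDeriv (k j n) (expSum (c n) x) (z j) / (k j n).factorial * σ j i ^ (k j n) else 0) := by
    intro j i
    have h0 := hM j i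
    simp only [hc] at h0
    exact h0
  exact mem_twentyLocus_of_newton_openings δ Sη hSη c x hF z hρ hsep m hm α hα β k hvan' hβ σ hσ hσ0 ε hεalt hM'

end Summit.ValiantsHypothesis.ValiantsHypothesis.Theorems.LacunarySymmetroidMatrixDescartes.WallBubbling
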